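import Summits.BirchSwinnertonDyer.BirchSwinnertonDyer.Theorems.SchneiderFreeAdditiveX3LocalTowerTorsionFiniteOfLine
import Summits.BirchSwinnertonDyer.BirchSwinnertonDyer.Theorems.SchneiderFreeAdditiveX3LocalGaloisDegreeOne
import Literature.NumberTheory.EllipticCurves.SelmerPInftyRestriction
import Literature.NumberTheory.EllipticCurves.GeomPointsGaloisModule
import HarnessLib

/-!
# The canonical line WITH ITS CHARACTER passes from `(ℚ̄, D_v)` to `(K̄, D_𝔭)` at a prime of degree one
# (crux `LocalTowerTorsionFiniteX3`, stmt-BirchSwinnertonDyer-19546 — FILE 3 of the hLine plan)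

Seat `bsd-schneider-door-c4` (cell `bsd-schneider-ideate`), gen 5; route `SchneiderFreeAdditiveX3`.
Hypothesis (ii) of `stub_finV_gordTwo_of_lineCharacter` (`…LocalTowerTorsionFiniteOfLine`, door-c5
gen 5) asks, at a prime `𝔭 ∣ p` of an imaginary quadratic `K` with `p` split, for a `D_𝔭`-stable
subgroup `C ≤ E_K[p^∞]` with one cyclic layer and points of every order, an element of `D_𝔭` acting as
`−1` modulo `C`, and the CHARACTER of `C`: an element of `Γ_{K_𝔭}` of Frobenius degree `n` acts on
`C[p^k]` by `± ε · α^{−n}`.  The tree produces such a line for `E/ℚ` at the place `v ∋ p` OF `ℚ`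
(Greenberg's reduction line of the good ordinary `p*`-twist, n1011 `IsRamifiedOrdinaryLine`; its
Frobenius character is FILE 1 of the plan, door-c6 gen 3).  This file is the fact-free TRANSPORT from
`(ℚ̄, D_v)` to `(K̄, D_𝔭)` for ANY number field `K` and any prime `𝔭 ∣ v` of degree one
(`e(𝔭|v) = f(𝔭|v) = 1`), on the number-field plumbing of `…LocalGaloisDegreeOne` (the two routes
`Γ_{K_𝔭} → Γ_ℚ` are conjugate by a fixed `τ`; at degree one `Γ_{K_𝔭} → Γ_{ℚ_v}` is onto, preserves
Frobenius degrees and the cyclotomic character):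

* §2 `lineCharacter_baseChange_of_degreeOne` — pushing `τ • C` through the coefficient isomorphism
  `E[p^∞](ℚ̄) ≃ E_K[p^∞](K̄)` (`primaryBaseChangeEquiv`) carries all six clauses of the line hypothesis
  from `(ℚ, v)` to `(K, 𝔭)`; the conclusion is the `∃`-body of door-c5's `hLine` VERBATIM;
* §3 `lineCharacter_baseChange_of_splitsIn` — the door's frames (`K` imaginary quadratic, `p` split);
* §4 `hLine_gordTwo_of_rat` and `stub_finV_gordTwo_of_lineCharacterRat` — hypothesis (ii), resp. the
  REGISTERED stub `stub_finV_gordTwo` of crux r5 (signature verbatim), from (i) the LCFT fact and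
  (ii-ℚ) the line with character AT THE PLACE OF `ℚ` (to be discharged by FILES 1–2).

Proofs only (no definition, no named fact, no `sorry`); helper for stmt-BirchSwinnertonDyer-19546
(`--supports`); closes nothing by itself; BSD is not advanced.  References: [SerreAbelianLadic1968]
Ch. I §2.1; [JetchevSkinnerWan2017] §3.3 Prop. 3.3.4 Case 3(b), Rem. 3.3.5 (arXiv:1512.06894 p. 13).
-/

noncomputable section

open scoped Classical

namespace Summit.BirchSwinnertonDyer.BirchSwinnertonDyer.Theorems.SchneiderFreeAdditiveX3

open NumberField IsDedekindDomain Field WeierstrassCurve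
  Literature.NumberTheory.EllipticCurves Literature.NumberTheory.EllipticCurves.GreenbergSelmer
  Literature.NumberTheory.GaloisRepresentations Literature.NumberTheory.Automorphic
  Summit.BirchSwinnertonDyer.Rank1Residual.X11b

set_option linter.dupNamespace false

/-! ## §2. Transport of the line with its character -/

section Transport

variable (W : WeierstrassCurve ℚ) {p : ℕ} [hp : Fact p.Prime]
  (K : Type) [Field K] [NumberField K] (v : HeightOneSpectrum (𝓞 ℚ))
  (𝔭 : HeightOneSpectrum (𝓞 K)) [h𝔭v : 𝔭.asIdeal.LiesOver v.asIdeal]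

omit hp h𝔭v in
/-- The coefficient isomorphism intertwines the two restrictions: for `τ` as in
`exists_absGaloisRestrict_adicCompletion_conj` and `f = primaryBaseChangeEquiv ∘ (τ • ·)`,
`res^K_𝔭 σ • f m = f (res^ℚ_v (σ|_{ℚ̄_v}) • m)`. [folklore] -/
theorem absGaloisRestrict_smul_primaryBaseChangeEquiv_smul
    [Algebra (v.adicCompletion ℚ) (𝔭.adicCompletion K)] {τ : absoluteGaloisGroup ℚ}
    (hτ : ∀ σ : absoluteGaloisGroup (𝔭.adicCompletion K),
      absGaloisRestrict ℚ K (absGaloisRestrict K (𝔭.adicCompletion K) σ) =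
        τ * absGaloisRestrict ℚ (v.adicCompletion ℚ)
              (absGaloisRestrict (v.adicCompletion ℚ) (𝔭.adicCompletion K) σ) * τ⁻¹)
    (σ : absoluteGaloisGroup (𝔭.adicCompletion K)) (m : W.geomPrimaryTorsion p) :
    absGaloisRestrict K (𝔭.adicCompletion K) σ • primaryBaseChangeEquiv K W p (τ • m) =
      primaryBaseChangeEquiv K W p (τ • (absGaloisRestrict ℚ (v.adicCompletion ℚ)
        (absGaloisRestrict (v.adicCompletion ℚ) (𝔭.adicCompletion K) σ) • m)) := by
  rw [primaryBaseChangeEquiv_apply, primaryBaseChangeEquiv_apply, ← primaryBaseChangeMap_smul,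
    resGal_eq_absGaloisRestrict, hτ σ, mul_smul, mul_smul, inv_smul_smul]

/-- **FILE 3 — the line with its character passes from `(ℚ̄, D_v)` to `(K̄, D_𝔭)` at a prime of degree
one.**  `W/ℚ` elliptic, `K` a number field, `𝔭 ∣ v` with `e(𝔭|v) = f(𝔭|v) = 1`.  Given, on
`E[p^∞](ℚ̄)`, a `D_v`-stable `C` with `#C[p] ≤ p`, points of every order `p^k`, an element of `D_v` acting
as `−1` modulo `C`, and the character clause (every `σ ∈ Γ_{ℚ_v}` of Frobenius degree `n` acts on
`C[p^k]` by `s·ε(σ)·α^{−n}`, `s = ±1`, `α² = aα − p`), the subgroup `f(C)`,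
`f = primaryBaseChangeEquiv ∘ (τ • ·)` (`τ` the conjugator of §1), satisfies the same six clauses on
`E_K[p^∞](K̄)` for `D_𝔭` and `Γ_{K_𝔭}` — the `∃`-body of hypothesis (ii) of
`stub_finV_gordTwo_of_lineCharacter`, verbatim.  Degree one enters twice: `Γ_{K_𝔭} → Γ_{ℚ_v}` is onto
(the `−1` element lifts) and preserves Frobenius degrees. [cite: SerreAbelianLadic1968, Ch. I §2.1]
[cite: JetchevSkinnerWan2017, §3.3 Prop. 3.3.4 Case 3(b) (arXiv:1512.06894 p. 13)] -/
theorem lineCharacter_baseChange_of_degreeOne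
    (he : 𝔭.asIdeal.ramificationIdx (𝓞 ℚ) = 1) (hf : 𝔭.asIdeal.inertiaDeg (𝓞 ℚ) = 1)
    (C : AddSubgroup (W.geomPrimaryTorsion p))
    (hCD : ∀ d ∈ decomp v, ∀ c ∈ C, d • c ∈ C)
    (hC1 : Set.ncard {c : W.geomPrimaryTorsion p | c ∈ C ∧ p • c = 0} ≤ p)
    (hCord : ∀ k : ℕ, ∃ c ∈ C, addOrderOf c = p ^ k)
    (hτ : ∃ τ ∈ decomp v, ∀ m : W.geomPrimaryTorsion p, τ • m + m ∈ C)
    (a : ℤ) (α : ℤ_[p]ˣ) (hα : ((α : ℤ_[p])) ^ 2 = a * (α : ℤ_[p]) - p)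
    (hchar : ∀ (σ : absoluteGaloisGroup (v.adicCompletion ℚ)) (n : ℕ), IsFrobPow σ (n : ℤ) →
      ∃ s : ℤ, (s = 1 ∨ s = -1) ∧
        ∀ (k : ℕ) (c : W.geomPrimaryTorsion p), c ∈ C → p ^ k • c = 0 →
          ∀ N : ℤ, ((N : ℤ_[p]) - s *
              ((GaloisRep.cyclotomicCharacter ℚ p (absGaloisRestrict ℚ (v.adicCompletion ℚ) σ) *
                (α⁻¹) ^ n : ℤ_[p]ˣ) : ℤ_[p]) ∈ (Ideal.span {(p : ℤ_[p]) ^ k} : Ideal ℤ_[p])) →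
            absGaloisRestrict ℚ (v.adicCompletion ℚ) σ • c = N • c) :
    ∃ (C : AddSubgroup ((W.baseChange K).geomPrimaryTorsion p)) (a : ℤ) (α : ℤ_[p]ˣ),
      (∀ d ∈ decomp 𝔭, ∀ c ∈ C, d • c ∈ C) ∧
      Set.ncard {c : (W.baseChange K).geomPrimaryTorsion p | c ∈ C ∧ p • c = 0} ≤ p ∧
      (∀ k : ℕ, ∃ c ∈ C, addOrderOf c = p ^ k) ∧
      (∃ τ ∈ decomp 𝔭, ∀ m : (W.baseChange K).geomPrimaryTorsion p, τ • m + m ∈ C) ∧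
      ((α : ℤ_[p])) ^ 2 = a * (α : ℤ_[p]) - p ∧
      (∀ (σ : absoluteGaloisGroup (𝔭.adicCompletion K)) (n : ℕ), IsFrobPow σ (n : ℤ) →
        ∃ s : ℤ, (s = 1 ∨ s = -1) ∧
          ∀ (k : ℕ) (c : (W.baseChange K).geomPrimaryTorsion p), c ∈ C → p ^ k • c = 0 →
            ∀ N : ℤ, ((N : ℤ_[p]) - s *
                ((GaloisRep.cyclotomicCharacter K p
                    (absGaloisRestrict K (𝔭.adicCompletion K) σ) * (α⁻¹) ^ n : ℤ_[p]ˣ) :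
                  ℤ_[p]) ∈ (Ideal.span {(p : ℤ_[p]) ^ k} : Ideal ℤ_[p])) →
              absGaloisRestrict K (𝔭.adicCompletion K) σ • c = N • c) := by
  letI := (adicCompletionOfLiesOver ℚ K v 𝔭).toAlgebra
  obtain ⟨τ, hτc⟩ := exists_absGaloisRestrict_adicCompletion_conj K v 𝔭
  -- the local restriction `Φ : Γ_{K_𝔭} → Γ_{ℚ_v}` and the transport `f = e ∘ (τ • ·)`
  set Φ := absGaloisRestrict (v.adicCompletion ℚ) (𝔭.adicCompletion K) with hΦ
  set e := primaryBaseChangeEquiv K W p with he_def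
  set g : W.geomPrimaryTorsion p ≃+ W.geomPrimaryTorsion p :=
    DistribMulAction.toAddEquiv (W.geomPrimaryTorsion p) τ with hg
  set f : W.geomPrimaryTorsion p ≃+ (W.baseChange K).geomPrimaryTorsion p := g.trans e with hf_def
  have hf_apply : ∀ m, f m = e (τ • m) := fun m => rfl
  have hkey : ∀ (σ : absoluteGaloisGroup (𝔭.adicCompletion K)) (m : W.geomPrimaryTorsion p),
      absGaloisRestrict K (𝔭.adicCompletion K) σ • f m =
        f (absGaloisRestrict ℚ (v.adicCompletion ℚ) (Φ σ) • m) := fun σ m => by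
    rw [hf_apply, hf_apply, he_def]
    exact absGaloisRestrict_smul_primaryBaseChangeEquiv_smul W K v 𝔭 hτc σ m
  refine ⟨C.map f.toAddMonoidHom, a, α, ?_, ?_, ?_, ?_, hα, ?_⟩
  · -- `D_𝔭`-stability
    intro d hd c hc
    obtain ⟨σ, rfl⟩ := (mem_decomp_iff 𝔭 d).mp hd
    obtain ⟨c₀, hc₀, rfl⟩ := AddSubgroup.mem_map.mp hc
    rw [AddEquiv.coe_toAddMonoidHom, hkey σ c₀]
    exact AddSubgroup.mem_map.mpr ⟨_, hCD _ ((mem_decomp_iff v _).mpr ⟨Φ σ, rfl⟩) c₀ hc₀, rfl⟩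
  · -- one cyclic layer
    have hset : {c : (W.baseChange K).geomPrimaryTorsion p | c ∈ C.map f.toAddMonoidHom ∧ p • c = 0} =
        f '' {c : W.geomPrimaryTorsion p | c ∈ C ∧ p • c = 0} := by
      ext c
      simp only [Set.mem_setOf_eq, Set.mem_image, AddSubgroup.mem_map, AddEquiv.coe_toAddMonoidHom]
      constructor
      · rintro ⟨⟨c₀, hc₀, rfl⟩, hpc⟩
        refine ⟨c₀, ⟨hc₀, ?_⟩, rfl⟩
        apply f.injective
        rw [map_nsmul, hpc, map_zero]
      · rintro ⟨c₀, ⟨hc₀, hpc⟩, rfl⟩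
        exact ⟨⟨c₀, hc₀, rfl⟩, by rw [← map_nsmul, hpc, map_zero]⟩
    rw [hset, Set.ncard_image_of_injective _ f.injective]
    exact hC1
  · -- points of every order
    intro k
    obtain ⟨c, hc, hord⟩ := hCord k
    refine ⟨f c, AddSubgroup.mem_map.mpr ⟨c, hc, rfl⟩, ?_⟩
    rw [AddEquiv.addOrderOf_eq, hord]
  · -- the `−1` element lifts (degree one: `Φ` is onto)
    obtain ⟨τ₀, hτ₀D, hτ₀⟩ := hτ
    obtain ⟨σ₁, rfl⟩ := (mem_decomp_iff v τ₀).mp hτ₀D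
    obtain ⟨σ, rfl⟩ := absGaloisRestrict_adicCompletion_surjective_of_degreeOne K v 𝔭 he hf σ₁
    refine ⟨absGaloisRestrict K (𝔭.adicCompletion K) σ, (mem_decomp_iff 𝔭 _).mpr ⟨σ, rfl⟩,
      fun m => ?_⟩
    obtain ⟨m₀, rfl⟩ := f.surjective m
    rw [hkey σ m₀, ← map_add]
    exact AddSubgroup.mem_map.mpr ⟨_, hτ₀ m₀, rfl⟩
  · -- the character
    intro σ n hσ
    have hΦσ : IsFrobPow (Φ σ) (n : ℤ) :=
      isFrobPow_absGaloisRestrict_adicCompletion_of_inertiaDeg_eq_one K v 𝔭 hf hσ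
    obtain ⟨s, hs1, hsc⟩ := hchar (Φ σ) n hΦσ
    refine ⟨s, hs1, fun k c hc hpk N hN => ?_⟩
    obtain ⟨c₀, hc₀, rfl⟩ := AddSubgroup.mem_map.mp hc
    rw [AddEquiv.coe_toAddMonoidHom] at hpk ⊢
    have hpk₀ : p ^ k • c₀ = 0 := by
      apply f.injective
      rw [map_nsmul, hpk, map_zero]
    rw [cyclotomicCharacter_adicCompletion_eq_of_conj K v 𝔭 p hτc σ] at hN
    rw [hkey σ c₀, hsc k c₀ hc₀ hpk₀ N hN, map_zsmul]

end Transport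

/-! ## §3. Split primes of an imaginary quadratic field; the (G-ord, `e = 2`) stub from the `ℚ`-side line -/

section Split

variable {K : Type} [Field K] [NumberField K] {p : ℕ} [hp : Fact p.Prime]

/-- A place `v ∋ p` of `ℚ` is the place `ratPlace p`. [folklore] -/
theorem eq_ratPlace_of_natCast_mem {v : HeightOneSpectrum (𝓞 ℚ)} (hpv : ((p : ℕ) : 𝓞 ℚ) ∈ v.asIdeal) :
    v = ratPlace p :=
  (natCast_mem_asIdeal_iff_eq_primesEquiv_symm v hp.out).mp hpv

/-- A prime `𝔭 ∋ p` of `𝓞_K` lies over any place `v ∋ p` of `ℚ`. [folklore] -/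
theorem liesOver_of_natCast_mem {v : HeightOneSpectrum (𝓞 ℚ)} (hpv : ((p : ℕ) : 𝓞 ℚ) ∈ v.asIdeal)
    {𝔭 : HeightOneSpectrum (𝓞 K)} (h𝔭 : ((p : ℕ) : 𝓞 K) ∈ 𝔭.asIdeal) :
    𝔭.asIdeal.LiesOver v.asIdeal := by
  have h : 𝔭.under (𝓞 ℚ) = v := by
    rw [under_eq_ratPlace_of_mem h𝔭, eq_ratPlace_of_natCast_mem hpv]
  exact ⟨(congrArg HeightOneSpectrum.asIdeal h).symm⟩

variable (W : WeierstrassCurve ℚ) (K)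

/-- **FILE 3 on the door's frames**: `K` imaginary quadratic, `p` split in `K`, `𝔭 ∋ p`, `v ∋ p` the
place of `ℚ` — then `𝔭 ∣ v` has degree one (`degreeOne_of_splitsIn`) and
`lineCharacter_baseChange_of_degreeOne` applies: a line with character for `E` at `(ℚ, v)` yields one
for `E_K` at `(K, 𝔭)`. [cite: JetchevSkinnerWan2017, §3.3 Prop. 3.3.4 Case 3(b) (arXiv:1512.06894 p. 13)] -/
theorem lineCharacter_baseChange_of_splitsIn (hK : IsImaginaryQuadratic K) (hsplit : SplitsIn K p)
    {v : HeightOneSpectrum (𝓞 ℚ)} (hpv : ((p : ℕ) : 𝓞 ℚ) ∈ v.asIdeal)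
    (𝔭 : HeightOneSpectrum (𝓞 K)) (h𝔭 : ((p : ℕ) : 𝓞 K) ∈ 𝔭.asIdeal)
    (C : AddSubgroup (W.geomPrimaryTorsion p))
    (hCD : ∀ d ∈ decomp v, ∀ c ∈ C, d • c ∈ C)
    (hC1 : Set.ncard {c : W.geomPrimaryTorsion p | c ∈ C ∧ p • c = 0} ≤ p)
    (hCord : ∀ k : ℕ, ∃ c ∈ C, addOrderOf c = p ^ k)
    (hτ : ∃ τ ∈ decomp v, ∀ m : W.geomPrimaryTorsion p, τ • m + m ∈ C)
    (a : ℤ) (α : ℤ_[p]ˣ) (hα : ((α : ℤ_[p])) ^ 2 = a * (α : ℤ_[p]) - p)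
    (hchar : ∀ (σ : absoluteGaloisGroup (v.adicCompletion ℚ)) (n : ℕ), IsFrobPow σ (n : ℤ) →
      ∃ s : ℤ, (s = 1 ∨ s = -1) ∧
        ∀ (k : ℕ) (c : W.geomPrimaryTorsion p), c ∈ C → p ^ k • c = 0 →
          ∀ N : ℤ, ((N : ℤ_[p]) - s *
              ((GaloisRep.cyclotomicCharacter ℚ p (absGaloisRestrict ℚ (v.adicCompletion ℚ) σ) *
                (α⁻¹) ^ n : ℤ_[p]ˣ) : ℤ_[p]) ∈ (Ideal.span {(p : ℤ_[p]) ^ k} : Ideal ℤ_[p])) →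
            absGaloisRestrict ℚ (v.adicCompletion ℚ) σ • c = N • c) :
    ∃ (C : AddSubgroup ((W.baseChange K).geomPrimaryTorsion p)) (a : ℤ) (α : ℤ_[p]ˣ),
      (∀ d ∈ decomp 𝔭, ∀ c ∈ C, d • c ∈ C) ∧
      Set.ncard {c : (W.baseChange K).geomPrimaryTorsion p | c ∈ C ∧ p • c = 0} ≤ p ∧
      (∀ k : ℕ, ∃ c ∈ C, addOrderOf c = p ^ k) ∧
      (∃ τ ∈ decomp 𝔭, ∀ m : (W.baseChange K).geomPrimaryTorsion p, τ • m + m ∈ C) ∧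
      ((α : ℤ_[p])) ^ 2 = a * (α : ℤ_[p]) - p ∧
      (∀ (σ : absoluteGaloisGroup (𝔭.adicCompletion K)) (n : ℕ), IsFrobPow σ (n : ℤ) →
        ∃ s : ℤ, (s = 1 ∨ s = -1) ∧
          ∀ (k : ℕ) (c : (W.baseChange K).geomPrimaryTorsion p), c ∈ C → p ^ k • c = 0 →
            ∀ N : ℤ, ((N : ℤ_[p]) - s *
                ((GaloisRep.cyclotomicCharacter K p
                    (absGaloisRestrict K (𝔭.adicCompletion K) σ) * (α⁻¹) ^ n : ℤ_[p]ˣ) :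
                  ℤ_[p]) ∈ (Ideal.span {(p : ℤ_[p]) ^ k} : Ideal ℤ_[p])) →
              absGaloisRestrict K (𝔭.adicCompletion K) σ • c = N • c) := by
  haveI := liesOver_of_natCast_mem hpv h𝔭
  obtain ⟨he, hf⟩ := degreeOne_of_splitsIn hK.1 hsplit h𝔭
  exact lineCharacter_baseChange_of_degreeOne W K v 𝔭 he hf C hCD hC1 hCord hτ a α hα hchar

end Split

/-! ## §4. Hypothesis (ii) of crux r5 on (G-ord, `e = 2`) from the line with character AT THE PLACE OF `ℚ` -/

section Stub

/-- **Hypothesis (ii) of `stub_finV_gordTwo_of_lineCharacter` from its `ℚ`-side version.**  If every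
`W` of the cell (G-ord, `e = 2`) carries, at every place `v ∋ p` of `ℚ`, a `D_v`-stable line with the
six clauses (Greenberg's reduction line of the good ordinary `p*`-twist WITH ITS CHARACTER: FILES 1–2 of
the hLine plan), then it carries one at every `(K, 𝔭)`, `K` imaginary quadratic with `p` split — the
`hLine` binder of door-c5's theorem, verbatim. [cite: JetchevSkinnerWan2017, §3.3 Prop. 3.3.4 Case 3(b) (arXiv:1512.06894 p. 13)] -/
theorem hLine_gordTwo_of_rat
    (hLineQ : ∀ (W : WeierstrassCurve ℚ) [W.IsElliptic] [W.IsGloballyMinimal] (p : ℕ) [Fact p.Prime],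
      W.analyticRank = 1 → p ≠ 2 → Literature.NumberTheory.EllipticCurves.Rank1Residual.ClassX3 W p →
        Summit.BirchSwinnertonDyer.Rank1Residual.Additive.SubGordTwo W p →
        ∀ (v : HeightOneSpectrum (𝓞 ℚ)), ((p : ℕ) : 𝓞 ℚ) ∈ v.asIdeal →
          ∃ (C : AddSubgroup (W.geomPrimaryTorsion p)) (a : ℤ) (α : ℤ_[p]ˣ),
            (∀ d ∈ decomp v, ∀ c ∈ C, d • c ∈ C) ∧
            Set.ncard {c : W.geomPrimaryTorsion p | c ∈ C ∧ p • c = 0} ≤ p ∧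
            (∀ k : ℕ, ∃ c ∈ C, addOrderOf c = p ^ k) ∧
            (∃ τ ∈ decomp v, ∀ m : W.geomPrimaryTorsion p, τ • m + m ∈ C) ∧
            ((α : ℤ_[p])) ^ 2 = a * (α : ℤ_[p]) - p ∧
            (∀ (σ : absoluteGaloisGroup (v.adicCompletion ℚ)) (n : ℕ), IsFrobPow σ (n : ℤ) →
              ∃ s : ℤ, (s = 1 ∨ s = -1) ∧
                ∀ (k : ℕ) (c : W.geomPrimaryTorsion p), c ∈ C → p ^ k • c = 0 →
                  ∀ N : ℤ, ((N : ℤ_[p]) - s *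
                      ((GaloisRep.cyclotomicCharacter ℚ p
                          (absGaloisRestrict ℚ (v.adicCompletion ℚ) σ) * (α⁻¹) ^ n : ℤ_[p]ˣ) :
                        ℤ_[p]) ∈ (Ideal.span {(p : ℤ_[p]) ^ k} : Ideal ℤ_[p])) →
                    absGaloisRestrict ℚ (v.adicCompletion ℚ) σ • c = N • c)) :
    ∀ (W : WeierstrassCurve ℚ) [W.IsElliptic] [W.IsGloballyMinimal] (p : ℕ) [Fact p.Prime],
      W.analyticRank = 1 → p ≠ 2 → Literature.NumberTheory.EllipticCurves.Rank1Residual.ClassX3 W p →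
        Summit.BirchSwinnertonDyer.Rank1Residual.Additive.SubGordTwo W p →
        ∀ (K : Type) [Field K] [NumberField K], IsImaginaryQuadratic K → SplitsIn K p →
          ∀ (𝔭 : HeightOneSpectrum (𝓞 K)), ((p : ℕ) : 𝓞 K) ∈ 𝔭.asIdeal →
          ∃ (C : AddSubgroup ((W.baseChange K).geomPrimaryTorsion p)) (a : ℤ) (α : ℤ_[p]ˣ),
            (∀ d ∈ decomp 𝔭, ∀ c ∈ C, d • c ∈ C) ∧
            Set.ncard {c : (W.baseChange K).geomPrimaryTorsion p | c ∈ C ∧ p • c = 0} ≤ p ∧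
            (∀ k : ℕ, ∃ c ∈ C, addOrderOf c = p ^ k) ∧
            (∃ τ ∈ decomp 𝔭, ∀ m : (W.baseChange K).geomPrimaryTorsion p, τ • m + m ∈ C) ∧
            ((α : ℤ_[p])) ^ 2 = a * (α : ℤ_[p]) - p ∧
            (∀ (σ : absoluteGaloisGroup (𝔭.adicCompletion K)) (n : ℕ), IsFrobPow σ (n : ℤ) →
              ∃ s : ℤ, (s = 1 ∨ s = -1) ∧
                ∀ (k : ℕ) (c : (W.baseChange K).geomPrimaryTorsion p), c ∈ C → p ^ k • c = 0 →
                  ∀ N : ℤ, ((N : ℤ_[p]) - s *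
                      ((GaloisRep.cyclotomicCharacter K p
                          (absGaloisRestrict K (𝔭.adicCompletion K) σ) * (α⁻¹) ^ n : ℤ_[p]ˣ) :
                        ℤ_[p]) ∈ (Ideal.span {(p : ℤ_[p]) ^ k} : Ideal ℤ_[p])) →
                    absGaloisRestrict K (𝔭.adicCompletion K) σ • c = N • c) := by
  intro W _ _ p _ hr hp2 hX hcell K _ _ hK hsplit 𝔭 h𝔭
  have hpv : ((p : ℕ) : 𝓞 ℚ) ∈ (ratPlace p).asIdeal :=
    (natCast_mem_asIdeal_iff_eq_primesEquiv_symm (ratPlace p) Fact.out).mpr rfl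
  obtain ⟨C, a, α, hCD, hC1, hCord, hτ, hα, hchar⟩ := hLineQ W p hr hp2 hX hcell (ratPlace p) hpv
  exact lineCharacter_baseChange_of_splitsIn K W hK hsplit hpv 𝔭 h𝔭 C hCD hC1 hCord hτ a α hα hchar

/-- **Registered stub `stub_finV_gordTwo` of crux `LocalTowerTorsionFiniteX3`
(stmt-BirchSwinnertonDyer-19546), CONDITIONALLY, with hypothesis (ii) AT THE PLACE OF `ℚ`** — signature
verbatim, from (i) the LCFT fact `ZpExtension.exists_isFrobPow_mem_kerSubgroup_of_isAnticyclotomic` and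
(ii-ℚ) the line with character of the cell (G-ord, `e = 2`) on `E[p^∞](ℚ̄)` at `v ∋ p` (Greenberg's
reduction line of the good ordinary `p*`-twist; its transport to `(K, 𝔭)` is this file's §2–§3).
[cite: JetchevSkinnerWan2017, §3.3 Prop. 3.3.4 Case 3(b), Remark 3.3.5 (arXiv:1512.06894 p. 13)] -/
theorem stub_finV_gordTwo_of_lineCharacterRat
    (hCFT : ∀ (K : Type) [Field K] [NumberField K] (p : ℕ) [Fact p.Prime],
      ZpExtension.exists_isFrobPow_mem_kerSubgroup_of_isAnticyclotomic K p)
    (hLineQ : ∀ (W : WeierstrassCurve ℚ) [W.IsElliptic] [W.IsGloballyMinimal] (p : ℕ) [Fact p.Prime],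
      W.analyticRank = 1 → p ≠ 2 → Literature.NumberTheory.EllipticCurves.Rank1Residual.ClassX3 W p →
        Summit.BirchSwinnertonDyer.Rank1Residual.Additive.SubGordTwo W p →
        ∀ (v : HeightOneSpectrum (𝓞 ℚ)), ((p : ℕ) : 𝓞 ℚ) ∈ v.asIdeal →
          ∃ (C : AddSubgroup (W.geomPrimaryTorsion p)) (a : ℤ) (α : ℤ_[p]ˣ),
            (∀ d ∈ decomp v, ∀ c ∈ C, d • c ∈ C) ∧
            Set.ncard {c : W.geomPrimaryTorsion p | c ∈ C ∧ p • c = 0} ≤ p ∧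
            (∀ k : ℕ, ∃ c ∈ C, addOrderOf c = p ^ k) ∧
            (∃ τ ∈ decomp v, ∀ m : W.geomPrimaryTorsion p, τ • m + m ∈ C) ∧
            ((α : ℤ_[p])) ^ 2 = a * (α : ℤ_[p]) - p ∧
            (∀ (σ : absoluteGaloisGroup (v.adicCompletion ℚ)) (n : ℕ), IsFrobPow σ (n : ℤ) →
              ∃ s : ℤ, (s = 1 ∨ s = -1) ∧
                ∀ (k : ℕ) (c : W.geomPrimaryTorsion p), c ∈ C → p ^ k • c = 0 →
                  ∀ N : ℤ, ((N : ℤ_[p]) - s *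
                      ((GaloisRep.cyclotomicCharacter ℚ p
                          (absGaloisRestrict ℚ (v.adicCompletion ℚ) σ) * (α⁻¹) ^ n : ℤ_[p]ˣ) :
                        ℤ_[p]) ∈ (Ideal.span {(p : ℤ_[p]) ^ k} : Ideal ℤ_[p])) →
                    absGaloisRestrict ℚ (v.adicCompletion ℚ) σ • c = N • c)) :
    ∀ (W : WeierstrassCurve ℚ) [W.IsElliptic] [W.IsGloballyMinimal] (p : ℕ) [Fact p.Prime],
      W.analyticRank = 1 → p ≠ 2 → Literature.NumberTheory.EllipticCurves.Rank1Residual.ClassX3 W p →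
        Summit.BirchSwinnertonDyer.Rank1Residual.Additive.SubGordTwo W p →
        (∀ (K : Type) [Field K] [NumberField K],
          Literature.NumberTheory.EllipticCurves.IsImaginaryQuadratic K →
          Summit.BirchSwinnertonDyer.Rank1Residual.X11b.SplitsIn K p →
          ∀ (κ : Literature.NumberTheory.EllipticCurves.ZpExtension K p), κ.IsAnticyclotomic →
          ∀ (𝔭 : IsDedekindDomain.HeightOneSpectrum (NumberField.RingOfIntegers K)),
            ((p : ℕ) : NumberField.RingOfIntegers K) ∈ 𝔭.asIdeal →
            (FixedPoints.addSubgroup ↥(Literature.NumberTheory.EllipticCurves.GreenbergSelmer.decomp 𝔭 ⊓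
              κ.kerSubgroup) ((W.baseChange K).geomPrimaryTorsion p) :
            Set ((W.baseChange K).geomPrimaryTorsion p)).Finite) :=
  stub_finV_gordTwo_of_lineCharacter hCFT (hLine_gordTwo_of_rat hLineQ)

end Stub

end Summit.BirchSwinnertonDyer.BirchSwinnertonDyer.Theorems.SchneiderFreeAdditiveX3

end
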